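import Summits.BirchSwinnertonDyer.BirchSwinnertonDyer.Theorems.GoldfeldAllTwistsTwoConverseTwinAdditiveInertTwistSelmer
import Literature.NumberTheory.EllipticCurves.TwoIsogenySelmerGroupRankProofs
import Literature.NumberTheory.EllipticCurves.IsogenyTwoTorsionProofs
import Literature.NumberTheory.EllipticCurves.ComplexMultiplicationTwistIsogenyProofs
import Literature.NumberTheory.EllipticCurves.X1ElevenDescentLocal
import HarnessLib

set_option linter.dupNamespace false -- namespace `…BirchSwinnertonDyer.BirchSwinnertonDyer…` is the cell's (D-0017 nested layout)
set_option autoImplicit false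

/-!
# The even-discriminant Birch lemma for `X₀(49)` at `4`-rank zero, I: the algebraic core of the
# HALF-TRACE argument (abstract lemma, Case II by inertia, Case I by `2`-isogeny descent over `ℚ(i)`)

Cell `bsd-goldfeld`, seat `bsd-goldfeld-s1p-c201` (prover, gen 6), `--supports stmt-BirchSwinnertonDyer-20044`
(route decl `Summit.BirchSwinnertonDyer.BirchSwinnertonDyer.Theses.GoldfeldAllTwistsTwoConverse.RankOneTwoConverseCMSevenAdditiveTwo`,
K12₂″). Everything in this file is PROVED; the sequel `GoldfeldK12AdditiveTwoHalfTrace.lean` feeds it the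
genus-field half-trace datum of a level-`49` Heegner point over `ℚ(√−q)`, `q ≡ 5 (mod 8)`, `(q/7) = −1`
(ONE named input) and concludes clause (i) of LINE B49 and «Conjecture D(q)» on that family. HONEST
FRAMING: nothing here proves K12₂″ or BSD. Memo `HOME/BIRCH-HALFTRACE.md`; numerics kit `j259794`.

* §1 `halfTrace_add_ne_zero_and_ne`, `not_isOfFinAddOrder_of_halfTrace` — the ABSTRACT HALF-TRACE LEMMA:
  in an abelian group with commuting-free data `ρ, τ` (additive), `T` of order `2` fixed by `ρ`, and
  `A[2] ⊆ {0, T}`: if `z + τz = T`, Case I (`ρτ z₀ = z₀ ∧ z₀ + τz₀ = T`) and Case II (`ρτ z₁ = z₁ + T`)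
  are excluded for all elements, then `z + ρz` has INFINITE order (odd multiples preserve the relation;
  climbing the `2`-power ends in Case I or, through the degenerate relation `z' + τz' = 0`, in Case II).
* (Case II — `σ = ρτ` in the inertia group of a valuation of good reduction, `w(2) = 1` — is excluded in
  the sequel's `map_ne_add_of_inertia`, a one-line consequence of the tree's
  `map_eq_of_inertia_of_zsmul_sub_eq_zero`, Silverman VIII.1.5(b).)
* §3 the two-torsion model `E₊ : y² = x³ + 21x² + 112x = C₁ • X₀(49)` (`C₁ = ⟨1/2, 2, −1/2, −1⟩`,
  `T = (2,−1) ↦ T₊ = (0,0)`, `Δ = −2¹²·7³`), `E₊(L)[2] = ⟨T₊⟩` when `√−7 ∉ L`, and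
  `add_map_ne_twoTorsionPoint_of_fixed` — Case I is impossible over the Gaussian field: a `ρτ`-fixed
  `z₀ = (x, y) ∈ E₊(ℚ(i))` with `z₀ + τz₀ = T₊` has `λ = y/x ∈ ℚ`, `112/x − x ∈ ℚ·i`, and produces the
  rational point `(−λ², ·)` on the `2`-isogenous `E' : y² = x³ + 42x² − 7x` with `x`-class `[−1]`, whereas
  `α(E'(ℚ)) ⊆ S(42, −7) = S'(−21, 112) ⊆ {1, −7}` (tree `range_xSqClass_subset_image_twoIsogenySelmerGroup`,
  seat c301's `mem_of_mem_twoIsogenySelmerGroup'_inertTwist` at `m = 1`) and `−1 ∉ {1, −7}·ℚ*²`.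
PARTITION: none — RANK axis (S1⁺), inert prime family of K12PP-RINGCLASS §6 / TARGET §2 c301 B49.

References: [SilvermanAEC2009] VIII.1.5(b), X.4.2(b), X.4.9; [SilvermanTate2015] §3.5–3.6;
[GrossLMS1991] Prop. 5.3; [CoatesLiTianZhai2015] §2.
-/

noncomputable section

open scoped Classical NNReal

namespace Summit.BirchSwinnertonDyer.BirchSwinnertonDyer.Theorems.GoldfeldGoodTwists

open WeierstrassCurve NumberField Literature.NumberTheory Literature.NumberTheory.EllipticCurves

/-! ## §1 The abstract half-trace lemma (pure algebra) -/

/-- **Abstract half-trace lemma.** In an abelian group `A` with an additive map `ρ` fixing an element `T`,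
and any self-map `τ`: if `z + τ z = T`, if no `ρτ`-fixed `z₀` has `z₀ + τ z₀ = T` (Case I excluded) and no
`z₁` has `ρ (τ z₁) = z₁ + T` (Case II excluded), then `z + ρ z ∉ {0, T}`. (With `y = z + ρz = T` one gets
`ρ(τz) = ρ(T − z) = T − ρz = z`; with `y = 0`, `ρ(τz) = T + z`.) [folklore] -/
theorem halfTrace_add_ne_zero_and_ne {A : Type*} [AddCommGroup A] (ρ : A →+ A) (τ : A → A) {T z : A}
    (hρT : ρ T = T) (hz : z + τ z = T) (hI : ∀ z₀ : A, ρ (τ z₀) = z₀ → z₀ + τ z₀ ≠ T)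
    (hII : ∀ z₁ : A, ρ (τ z₁) ≠ z₁ + T) : z + ρ z ≠ 0 ∧ z + ρ z ≠ T := by
  have hτz : τ z = T - z := eq_sub_of_add_eq' hz
  refine ⟨fun h0 => ?_, fun hT => ?_⟩
  · have hρz : ρ z = -z := eq_neg_of_add_eq_zero_right h0
    refine hII z ?_
    rw [hτz, map_sub, hρT, hρz, sub_neg_eq_add, add_comm]
  · have hρz : ρ z = T - z := eq_sub_of_add_eq' hT
    refine hI z ?_ hz
    rw [hτz, map_sub, hρT, hρz, sub_sub_cancel]

/-- **The `2`-power reduction behind the half-trace lemma.** Same setting, with `τ` additive as well and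
`T + T = 0`, `τ T = T`; suppose moreover every `y` with `y + y = 0` lies in `{0, T}` ("`A[2] = ⟨T⟩`"). If
`z + τ z = T` and `z + ρ z` has finite additive order, then Case I or Case II occurs for SOME element; so
if both are excluded for all elements, `z + ρ z` has infinite order. (Multiply by the odd part `m'` of the
order — `m' z` still satisfies the half-trace relation — then climb the `2`-power: at the top either the
relation or its degenerate double `z'' + τ z'' = 0` meets `z'' + ρ z'' = T`, giving Case I resp. Case II.)
[folklore] -/
theorem not_isOfFinAddOrder_of_halfTrace {A : Type*} [AddCommGroup A] (ρ τ : A →+ A) {T z : A}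
    (hT2 : T + T = 0) (hρT : ρ T = T) (h2 : ∀ y : A, y + y = 0 → y = 0 ∨ y = T)
    (hz : z + τ z = T) (hI : ∀ z₀ : A, ρ (τ z₀) = z₀ → z₀ + τ z₀ ≠ T)
    (hII : ∀ z₁ : A, ρ (τ z₁) ≠ z₁ + T) : ¬ IsOfFinAddOrder (z + ρ z) := by
  intro hfin
  -- the non-degenerate relation with `z' + ρ z' ∈ {0, T}` is the abstract lemma
  have keyA : ∀ z' : A, z' + τ z' = T → (z' + ρ z' = 0 ∨ z' + ρ z' = T) → False := by
    intro z' hτ hρ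
    obtain ⟨h0, hT⟩ := halfTrace_add_ne_zero_and_ne ρ τ hρT hτ hI hII
    rcases hρ with h | h
    · exact h0 h
    · exact hT h
  -- the degenerate relation `z' + τ z' = 0` with `z' + ρ z' = T` is Case II for `z'`
  have keyB : ∀ z' : A, z' + τ z' = 0 → z' + ρ z' = T → False := by
    intro z' hτ hρ
    have hτz : τ z' = -z' := eq_neg_of_add_eq_zero_right hτ
    have hρz : ρ z' = T - z' := eq_sub_of_add_eq' hρ
    refine hII z' ?_
    rw [hτz, map_neg, hρz, neg_sub, show z' - T = z' + T - (T + T) by abel, hT2, sub_zero]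
  -- climb the `2`-power: induction on `k`, generalising the element
  have climb : ∀ (k : ℕ) (z₁ : A), z₁ + τ z₁ = T → (2 ^ k) • (z₁ + ρ z₁) = 0 → False := by
    intro k
    induction k with
    | zero =>
      intro z₁ hrel hord
      rw [pow_zero, one_smul] at hord
      exact keyA z₁ hrel (Or.inl hord)
    | succ k ih =>
      intro z₁ hrel hord
      -- either `2^k • y₁ = 0` already (induct), or `2^k • y₁` is a nonzero `2`-torsion element, `= T`
      by_cases hk : (2 ^ k) • (z₁ + ρ z₁) = 0
      · exact ih z₁ hrel hk
      · have hw2 : (2 ^ k) • (z₁ + ρ z₁) + (2 ^ k) • (z₁ + ρ z₁) = 0 := by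
          rw [← two_smul ℕ, ← mul_smul, ← pow_succ', hord]
        rcases h2 _ hw2 with h | h
        · exact hk h
        · -- `z₂ := 2^k • z₁` has `z₂ + ρ z₂ = T` and `z₂ + τ z₂ = 2^k • T ∈ {T, 0}`
          have hρ₂ : (2 ^ k) • z₁ + ρ ((2 ^ k) • z₁) = T := by rw [map_nsmul, ← smul_add, h]
          have hτ₂ : (2 ^ k) • z₁ + τ ((2 ^ k) • z₁) = (2 ^ k) • T := by
            rw [map_nsmul, ← smul_add, hrel]
          have hTk : (2 ^ k) • T = T ∨ (2 ^ k) • T = 0 := by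
            cases k with
            | zero => exact Or.inl (by rw [pow_zero, one_smul])
            | succ k => exact Or.inr (by rw [pow_succ, mul_smul, two_smul, hT2, smul_zero])
          rcases hTk with hTk | hTk
          · rw [hTk] at hτ₂
            exact keyA _ hτ₂ (Or.inr hρ₂)
          · rw [hTk] at hτ₂
            exact keyB _ hτ₂ hρ₂
  -- write the order as `2^k * m'` with `m'` odd; `m' • z` still satisfies the half-trace relation
  obtain ⟨n, hn, hnz⟩ := hfin.exists_nsmul_eq_zero
  obtain ⟨k, m', hm', hnm⟩ := Nat.exists_eq_two_pow_mul_odd hn.ne'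
  have hodd : m' • T = T := by
    obtain ⟨j, rfl⟩ := hm'
    rw [add_smul, one_smul, mul_comm, mul_smul, two_smul, hT2, smul_zero, zero_add]
  refine climb k (m' • z) (by rw [map_nsmul, ← smul_add, hz, hodd]) ?_
  rw [map_nsmul, ← smul_add, ← mul_smul, ← hnm, hnz]

/-! ## §3 The two-torsion model `E₊ : y² = x³ + 21x² + 112x` of `X₀(49)`, its `2`-torsion, and Case I -/

/-- **The two-torsion model `E₊ : y² = x³ + 21x² + 112x` of `X₀(49) = cm7`**: `E₊ = C₁ • cm7` for
`C₁ = ⟨u = 1/2, r = 2, s = −1/2, t = −1⟩`, i.e. `(x, y) ↦ (4(x − 2), 8y + 4x)`, which moves the rational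
`2`-torsion point `T = (2, −1)` (the image of the cusp `0`) to `T₊ = (0, 0)`; it is seat c301's `E_d` at
`d = 1` (`twoTorsionModel_eq_smul_quadraticTwist`). `b = 112 = 2⁴·7`, `a² − 4b = −7`, `Δ(E₊) = −2¹²·7³`.
The curve is written as the literal `⟨0, 21, 0, 112, 0⟩` throughout (tree convention, `isTwoTorsionNF_mk`).
[cite: SilvermanAEC2009, III.1 Table 3.1 and X.4.9] -/
theorem smul_cm7_eq_twoTorsionModel :
    (⟨(Units.mk0 (2 : ℚ) two_ne_zero)⁻¹, 2, -1 / 2, -1⟩ : VariableChange ℚ) • cm7 =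
      (⟨0, 21, 0, 112, 0⟩ : WeierstrassCurve ℚ) := by
  ext <;> simp [variableChange_a₁, variableChange_a₂, variableChange_a₃, variableChange_a₄,
    variableChange_a₆] <;> norm_num

section Model

variable (L : Type*) [Field L] [CharZero L]

/-- Coefficients of `E₊` over any field of characteristic `0`. [folklore] -/
@[simp] theorem twoTorsionModel_baseChange_a₂ : ((⟨0, 21, 0, 112, 0⟩ : WeierstrassCurve ℚ).baseChange L).a₂ = 21 := by
  simp [baseChange, map]

/-- Coefficients of `E₊` over any field of characteristic `0`. [folklore] -/
@[simp] theorem twoTorsionModel_baseChange_a₄ : ((⟨0, 21, 0, 112, 0⟩ : WeierstrassCurve ℚ).baseChange L).a₄ = 112 := by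
  simp [baseChange, map]

/-- `Δ(E₊) = −2¹²·7³` over any field of characteristic `0`. [folklore] -/
theorem twoTorsionModel_baseChange_Δ : ((⟨0, 21, 0, 112, 0⟩ : WeierstrassCurve ℚ).baseChange L).Δ = -(2 ^ 12 * 7 ^ 3) := by
  simp [baseChange, map, Δ, b₂, b₄, b₆, b₈]
  norm_num

/-- `E₊` is an elliptic curve over any field of characteristic `0` (provided as a theorem; users write
`haveI := isElliptic_twoTorsionModel_baseChange L`). [folklore] -/
theorem isElliptic_twoTorsionModel_baseChange : ((⟨0, 21, 0, 112, 0⟩ : WeierstrassCurve ℚ).baseChange L).IsElliptic := by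
  rw [isElliptic_iff, twoTorsionModel_baseChange_Δ]
  exact (neg_ne_zero.mpr (by norm_num)).isUnit

/-- `T₊ = (0, 0)` is a nonsingular point of `E₊` (so that the sequel can name it without an instance:
`Affine.Point.some 0 0 (nonsingular_zero_zero_twoTorsionModel L)` is `twoTorsionPoint` by `rfl`). [folklore] -/
theorem nonsingular_zero_zero_twoTorsionModel : ((⟨0, 21, 0, 112, 0⟩ : WeierstrassCurve ℚ).baseChange L).toAffine.Nonsingular 0 0 := by
  haveI := isElliptic_twoTorsionModel_baseChange L
  exact nonsingular_zero_zero _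

/-- `E₊` has integral coefficients at every valuation `w` of `L`. [folklore] -/
theorem isIntegral_twoTorsionModel_baseChange (w : Valuation L ℝ≥0) :
    ((⟨0, 21, 0, 112, 0⟩ : WeierstrassCurve ℚ).baseChange L).IsIntegral w.integer := by
  have h21 : (21 : L) ∈ w.integer := (Valuation.mem_integer_iff _ _).mpr (by
    exact_mod_cast val_natCast_le_one w 21)
  have h112 : (112 : L) ∈ w.integer := (Valuation.mem_integer_iff _ _).mpr (by
    exact_mod_cast val_natCast_le_one w 112)
  refine WeierstrassCurve.isIntegral_of_exists_lift (R := w.integer) ⟨0, ?_⟩ ⟨⟨21, h21⟩, ?_⟩ ⟨0, ?_⟩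
    ⟨⟨112, h112⟩, ?_⟩ ⟨0, ?_⟩ <;>
    simp [baseChange, map] <;> rfl

/-- **`E₊(L)[2] = {O, T₊}` whenever `−7` is not a square in `L`**: a point of order `2` has `y = 0` and
`x(x² + 21x + 112) = 0`, and `x² + 21x + 112 = 0` means `(2x + 21)² = −7`. (For `L = ℚ(i, √−q)`,
`q ≠ 7`: `√−7 ∉ L`.) [folklore] -/
theorem eq_zero_or_eq_twoTorsionPoint_of_add_self_eq_zero
    [((⟨0, 21, 0, 112, 0⟩ : WeierstrassCurve ℚ).baseChange L).IsElliptic] (h7 : ∀ x : L, x ^ 2 ≠ -7)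
    (Q : ((⟨0, 21, 0, 112, 0⟩ : WeierstrassCurve ℚ).baseChange L).toAffine.Point) (hQ : Q + Q = 0) :
    Q = 0 ∨ Q = ((⟨0, 21, 0, 112, 0⟩ : WeierstrassCurve ℚ).baseChange L).twoTorsionPoint := by
  rcases Q with _ | ⟨x, y, h⟩
  · exact Or.inl rfl
  · right
    have hneg : (Affine.Point.some x y h : ((⟨0, 21, 0, 112, 0⟩ : WeierstrassCurve ℚ).baseChange L).toAffine.Point) =
        -Affine.Point.some x y h := eq_neg_of_add_eq_zero_left hQ
    rw [Affine.Point.neg_some, Affine.Point.some.injEq] at hneg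
    have hy : y = 0 := by
      have e := hneg.2
      rw [negY_of_isTwoTorsionNF] at e
      linear_combination e / 2
    have e := rel_of_nonsingular _ h
    rw [hy, twoTorsionModel_baseChange_a₂, twoTorsionModel_baseChange_a₄] at e
    have hx : x = 0 := by
      by_contra hx
      refine h7 (2 * x + 21) ?_
      have : x * (x ^ 2 + 21 * x + 112) = 0 := by linear_combination -e
      have h' : x ^ 2 + 21 * x + 112 = 0 := (mul_eq_zero.mp this).resolve_left hx
      linear_combination 4 * h'
    subst hx hy
    rfl

/-- Elements of a field of characteristic `0` fixed resp. negated by an involution `τ` with `τ i = −i`,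
inside the `ℚ`-span of `1, i`: `τ(u + vi) = u − vi`, so fixed elements are rational and anti-fixed ones
are rational multiples of `i`. [folklore] -/
theorem eq_ratCast_of_fixed {τ : L ≃ₐ[ℚ] L} {i : L} (hi : i ^ 2 = -1) (hτi : τ i = -i) {x : L}
    (hx : ∃ u v : ℚ, x = u + v * i) (hτx : τ x = x) : ∃ u : ℚ, x = u := by
  obtain ⟨u, v, rfl⟩ := hx
  have hi0 : i ≠ 0 := by rintro rfl; norm_num at hi
  have e : τ (u + v * i) = u - v * i := by
    rw [map_add, map_mul, hτi, map_ratCast, map_ratCast]; ring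
  rw [e] at hτx
  have hv : (v : L) * i = 0 := by linear_combination -hτx / 2
  rcases mul_eq_zero.mp hv with hv | hv
  · exact ⟨u, by rw [show (v : L) = 0 from hv]; ring⟩
  · exact absurd hv hi0

/-- Companion: anti-fixed elements are rational multiples of `i`. [folklore] -/
theorem eq_ratCast_mul_of_neg {τ : L ≃ₐ[ℚ] L} {i : L} (hτi : τ i = -i) {x : L}
    (hx : ∃ u v : ℚ, x = u + v * i) (hτx : τ x = -x) : ∃ v : ℚ, x = v * i := by
  obtain ⟨u, v, rfl⟩ := hx
  have e : τ (u + v * i) = u - v * i := by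
    rw [map_add, map_mul, hτi, map_ratCast, map_ratCast]; ring
  rw [e] at hτx
  have hu : (u : L) = 0 := by linear_combination hτx / 2
  exact ⟨v, by rw [hu]; ring⟩

/-- `7` is not a rational square. [folklore] -/
theorem rat_sq_ne_seven (r : ℚ) : r ^ 2 ≠ 7 := by
  intro h
  have hr : r ≠ 0 := by rintro rfl; norm_num at h
  haveI : Fact (Nat.Prime 7) := ⟨by norm_num⟩
  have h1 : padicValRat 7 (r ^ 2) = padicValRat 7 7 := by rw [h]
  rw [padicValRat.pow, show (7 : ℚ) = ((7 : ℕ) : ℚ) by norm_num, padicValRat.self (by norm_num)] at h1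
  omega

/-- **Case I excluded: the `2`-isogeny descent over the Gaussian field.** Let `L ⊇ ℚ(i)` carry
`ℚ`-automorphisms `ρ, τ` with `τ i = −i` and `L^{ρτ} = ℚ ⊕ ℚi` (in the application `L = ℚ(i, √−q)`, `τ`
complex conjugation, `ρ` the generator of `Gal(L/ℚ(√−q))`), and `√−7 ∉ L`. Then NO `ρτ`-fixed point
`z₀ ∈ E₊(L)` (i.e. `z₀ ∈ E₊(ℚ(i))`) satisfies `z₀ + τz₀ = T₊`, i.e. `T₊` is not a norm from `E₊(ℚ(i))`.
Proof: with `z₀ = (x, y)`, `x ≠ 0`, the relation reads `τz₀ = T₊ − z₀ = (112/x, 112y/x²)`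
(`twoTorsionPoint_add_some`), so `λ = y/x` is `τ`-fixed (rational, `= u`) and `μ = 112/x − x` is
`τ`-negated (`= v i`); the point `(−u², uv)` then lies on `E' : y² = x³ + 42x² − 7x` over `ℚ`, the
`2`-isogenous curve, with `x`-class `[−1]` (if `u ≠ 0`) — but the classes of `E'(ℚ)` lie in
`S(42, −7) = S'(−21, 112) ⊆ {1, −7}` (tree `range_xSqClass_subset_image_twoIsogenySelmerGroup`; seat c301's
`mem_of_mem_twoIsogenySelmerGroup'_inertTwist` at `m = 1`), and `−1 ∉ {1, −7}·ℚ*²` (`7 ∉ ℚ*²`); if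
`u = 0` then `y = 0` and `(2x + 21)² = −7`. (Numerically, kit j259794: `E₊(ℚ(i)) = ⟨T₊⟩ ⊕ ℤ·g` up to odd
index with `g ↔ (0, i)` on `cm7`, and no norm equals `T₊`.) [cite: SilvermanAEC2009, Prop. X.4.9]
[cite: SilvermanTate2015, §3.5 (the map α)] -/
theorem add_map_ne_twoTorsionPoint_of_fixed (ρ τ : L ≃ₐ[ℚ] L) (i : L) (hi : i ^ 2 = -1)
    (hτi : τ i = -i) (hfix : ∀ x : L, ρ (τ x) = x → ∃ u v : ℚ, x = u + v * i)
    (h7 : ∀ x : L, x ^ 2 ≠ -7) [((⟨0, 21, 0, 112, 0⟩ : WeierstrassCurve ℚ).baseChange L).IsElliptic]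
    (z₀ : ((⟨0, 21, 0, 112, 0⟩ : WeierstrassCurve ℚ).baseChange L).toAffine.Point)
    (hz₀ : Affine.Point.map (ρ : L →ₐ[ℚ] L) (Affine.Point.map (τ : L →ₐ[ℚ] L) z₀) = z₀) :
    z₀ + Affine.Point.map (τ : L →ₐ[ℚ] L) z₀ ≠ ((⟨0, 21, 0, 112, 0⟩ : WeierstrassCurve ℚ).baseChange L).twoTorsionPoint := by
  intro hsum
  have hb : ((⟨0, 21, 0, 112, 0⟩ : WeierstrassCurve ℚ).baseChange L).a₄ = 112 := twoTorsionModel_baseChange_a₄ L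
  cases z₀ with
  | zero =>
    rw [← Affine.Point.zero_def, map_zero, add_zero] at hsum
    exact (Affine.Point.some_ne_zero _ hsum.symm).elim
  | some x y h =>
    -- the relation `τ z₀ = T₊ − z₀ = T₊ + (−z₀)`
    have hτz : Affine.Point.map (τ : L →ₐ[ℚ] L) (.some x y h) =
        ((⟨0, 21, 0, 112, 0⟩ : WeierstrassCurve ℚ).baseChange L).twoTorsionPoint + -(.some x y h) := by
      rw [← sub_eq_add_neg]; exact eq_sub_of_add_eq' hsum
    rw [Affine.Point.map_some, Affine.Point.neg_some] at hτz
    by_cases hx : x = 0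
    · -- `z₀ = T₊`: then `z₀ + τ z₀ = T₊ + T₊ = O ≠ T₊`
      have hy := y_eq_zero_of_x_eq_zero _ h hx
      subst hx hy
      have hT : (Affine.Point.some 0 0 h : ((⟨0, 21, 0, 112, 0⟩ : WeierstrassCurve ℚ).baseChange L).toAffine.Point) =
          ((⟨0, 21, 0, 112, 0⟩ : WeierstrassCurve ℚ).baseChange L).twoTorsionPoint := rfl
      rw [Affine.Point.map_some] at hsum
      simp only [map_zero] at hsum
      rw [hT, twoTorsionPoint_add_twoTorsionPoint] at hsum
      exact Affine.Point.some_ne_zero _ hsum.symm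
    · obtain ⟨h', e⟩ := twoTorsionPoint_add_some ((⟨0, 21, 0, 112, 0⟩ : WeierstrassCurve ℚ).baseChange L)
        ((Affine.nonsingular_neg _ _).mpr h) hx
      rw [e, Affine.Point.some.injEq, negY_of_isTwoTorsionNF, hb] at hτz
      obtain ⟨hτx, hτy⟩ := hτz
      change τ x = _ at hτx
      change τ y = _ at hτy
      -- coordinates fixed by `ρτ`
      rw [Affine.Point.map_some, Affine.Point.map_some, Affine.Point.some.injEq] at hz₀
      obtain ⟨hρτx, hρτy⟩ := hz₀
      change ρ (τ x) = x at hρτx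
      change ρ (τ y) = y at hρτy
      have h112 : (112 : L) ≠ 0 := by norm_num
      -- `λ = y/x` is `τ`-fixed and `ρτ`-fixed, hence rational
      have hlam_τ : τ (y / x) = y / x := by
        rw [map_div₀, hτx, hτy]; field_simp
      have hlam_ρτ : ρ (τ (y / x)) = y / x := by rw [map_div₀, map_div₀, hρτx, hρτy]
      obtain ⟨u, hu⟩ := eq_ratCast_of_fixed L hi hτi (hfix _ hlam_ρτ) hlam_τ
      -- `μ = 112/x − x` is `τ`-negated and `ρτ`-fixed, hence a rational multiple of `i`
      have hmu_τ : τ (112 / x - x) = -(112 / x - x) := by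
        rw [map_sub, map_div₀, hτx, map_ofNat]; field_simp; ring
      have hmu_ρτ : ρ (τ (112 / x - x)) = 112 / x - x := by
        rw [map_sub, map_sub, map_div₀, map_div₀, hρτx, map_ofNat, map_ofNat]
      obtain ⟨v, hv⟩ := eq_ratCast_mul_of_neg L hτi (hfix _ hmu_ρτ) hmu_τ
      -- the curve relation: `y² = x³ + 21x² + 112x`
      have e₀ := rel_of_nonsingular _ h
      rw [twoTorsionModel_baseChange_a₂, hb] at e₀
      by_cases hu0 : u = 0
      · -- `y = 0`: `x² + 21x + 112 = 0`, so `(2x + 21)² = −7`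
        have hy0 : y = 0 := by
          have : y / x = 0 := by rw [hu, hu0, Rat.cast_zero]
          simpa [hx] using this
        refine h7 (2 * x + 21) ?_
        rw [hy0] at e₀
        have h3 : x * (x ^ 2 + 21 * x + 112) = 0 := by linear_combination -e₀
        have h4 : x ^ 2 + 21 * x + 112 = 0 := (mul_eq_zero.mp h3).resolve_left hx
        linear_combination 4 * h4
      · -- the rational point `(−u², uv)` on `E' : y² = x³ + 42x² − 7x`
        have key : ((u : L) * v) ^ 2 = (-(u : L) ^ 2) ^ 3 + 42 * (-(u : L) ^ 2) ^ 2 - 7 * (-(u : L) ^ 2) := by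
          -- `u² = y²/x² = x + 21 + 112/x`, and the `2`-isogeny identity
          -- `(u μ)² = (u²)³ − 42 (u²)² − 7 u²` for `μ = 112/x − x = v i`, `i² = −1`
          have hu2 : (u : L) ^ 2 = x + 21 + 112 / x := by
            rw [← hu]; field_simp; linear_combination e₀
          have I1 : ((u : L) * (112 / x - x)) ^ 2 =
              ((u : L) ^ 2) ^ 3 - 42 * ((u : L) ^ 2) ^ 2 - 7 * (u : L) ^ 2 := by
            rw [mul_pow, hu2]; field_simp; ring
          rw [hv] at I1
          linear_combination (-1 : L) * I1 + ((u : L) * v) ^ 2 * hi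
        -- transfer the identity to `ℚ`
        have keyQ : (u * v) ^ 2 = (-u ^ 2) ^ 3 + 42 * (-u ^ 2) ^ 2 + (-7) * (-u ^ 2) := by
          have : ((((u * v) ^ 2 : ℚ)) : L) =
              (((-u ^ 2) ^ 3 + 42 * (-u ^ 2) ^ 2 + (-7) * (-u ^ 2) : ℚ) : L) := by
            push_cast; linear_combination key
          exact_mod_cast this
        -- the rational point and its `x`-class
        have hab : (-7 : ℤ) * ((42 : ℤ) ^ 2 - 4 * (-7)) ≠ 0 := by norm_num
        haveI := isElliptic_mk_of_ne_zero (F := ℚ) hab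
        have hns : (⟨0, ((42 : ℤ) : ℚ), 0, ((-7 : ℤ) : ℚ), 0⟩ : WeierstrassCurve ℚ).toAffine.Nonsingular
            (-u ^ 2) (u * v) := by
          refine Affine.equation_iff_nonsingular.mp ?_
          rw [equation_iff_of_isTwoTorsionNF]
          push_cast
          linear_combination keyQ
        have hxcl : (⟨0, ((42 : ℤ) : ℚ), 0, ((-7 : ℤ) : ℚ), 0⟩ : WeierstrassCurve ℚ).xSqClass (.some _ _ hns) =
            Affine.sqClass (-1 : ℚ) := by
          rw [xSqClass_some_of_ne_zero hns (neg_ne_zero.mpr (pow_ne_zero 2 hu0)),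
            show (-u ^ 2 : ℚ) = -1 * u ^ 2 by ring,
            Affine.sqClass_mul (by norm_num) (pow_ne_zero 2 hu0), Affine.sqClass_sq,
            Affine.SqUnits.mul_one]
        obtain ⟨d, hdS, hd⟩ : ∃ d ∈ twoIsogenySelmerGroup 42 (-7),
            Affine.sqClass (d : ℚ) = Affine.sqClass (-1 : ℚ) := by
          have hmem := range_xSqClass_subset_image_twoIsogenySelmerGroup hab ⟨_, hxcl⟩
          rw [Finset.coe_image] at hmem
          obtain ⟨d, hd, hdc⟩ := hmem
          exact ⟨d, hd, hdc⟩
        -- `S(42, −7) = S'(−21, 112) ⊆ {1, −7}` (seat c301, inert-twist family at `m = 1`)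
        have hd' : d ∈ twoIsogenySelmerGroup' (-21 * (1 : ℕ)) (112 * (1 : ℕ) ^ 2) := by
          rw [twoIsogenySelmerGroup'_eq]; norm_num; exact hdS
        have hd17 := mem_of_mem_twoIsogenySelmerGroup'_inertTwist (m := 1) one_pos squarefree_one
          (fun l hl hl1 => absurd (Nat.le_of_dvd one_pos hl1) (by have := hl.two_le; omega)) hd'
        simp only [Finset.mem_insert, Finset.mem_singleton] at hd17
        have hm1 : (-1 : ℚ) ≠ 0 := by norm_num
        rcases hd17 with rfl | rfl
        · -- `[−1] = [1]`: `−1` would be a rational square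
          rw [Int.cast_one, show Affine.sqClass (1 : ℚ) = 1 from by
            simpa using Affine.sqClass_sq (1 : ℚ)] at hd
          obtain ⟨t, ht⟩ := (Affine.sqClass_eq_one_iff hm1).mp hd.symm
          nlinarith [sq_nonneg t]
        · -- `[−1] = [−7]`: `7` would be a rational square
          push_cast at hd
          have h77 : Affine.sqClass ((-7 : ℚ) * -1) = 1 := by
            rw [Affine.sqClass_mul (by norm_num) hm1, hd, Affine.SqUnits.mul_self]
          obtain ⟨t, ht⟩ := (Affine.sqClass_eq_one_iff (by norm_num)).mp h77
          exact rat_sq_ne_seven t (by linear_combination -ht)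

end Model

end Summit.BirchSwinnertonDyer.BirchSwinnertonDyer.Theorems.GoldfeldGoodTwists

end
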